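import Summits.Ventures.HodgeRepro2.T5SU11SphericalBounds

/-!
# Continuity of the spherical functions of `SU(1,1)` in the group variable and in the parameter

The spherical functions `sph λ g = ∫_K e^{λ t(k g)} dk` of `T5SU11SphericalFunction` are **jointly
continuous in `(λ, g) ∈ ℝ × SU(1,1)`** (`continuous_sph_uncurry`); in particular every `sph λ` is a
continuous function on `SU(1,1)` (`continuous_sph`) and `λ ↦ sph λ g` is continuous for every `g`
(`continuous_sph_param`). The proof goes through Laplace's integral
`sph λ (a_t) = (2π)⁻¹ ∫_{-π}^{π} (cosh 2t - sinh 2t cos φ)^{-λ/2} dφ`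
(`T5SU11SphericalBounds.sph_hyp_eq_laplace`): the integrand is jointly continuous in `(λ, t, φ)` with a
positive base (`continuous_laplace_integrand`), so the parametric interval integral is continuous in
`(λ, t)` (`continuous_sph_hyp_uncurry`, Mathlib's
`intervalIntegral.continuous_parametric_intervalIntegral_of_continuous'`), and the Cartan projection
`cartanT` is continuous (`T5SU11CartanProjection.continuous_cartanT`). Also recorded: `sph λ k = 1` on
`K` (`sph_rot`). Nothing is claimed about (N).

Blind lane: Mathlib + the HodgeRepro2 prefix only; no sorry; axioms ⊆ {propext, Classical.choice,
Quot.sound}.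
-/

namespace Summit.Ventures.HodgeRepro2.T5SU11SphericalContinuous

open MeasureTheory Metric Set Complex intervalIntegral
open T5SU11Unimodular T5SU11Fibration T5SU11Cartan T5SU11OneParameter T5SU11CartanProjection
  T5HaarCircle T5SU11SphericalFunction T5SU11SphericalTwo T5SU11SphericalSymmetry
  T5SU11SphericalBounds
open scoped Real

/-! ### The Laplace integrand is jointly continuous -/

/-- `cosh 2t - sinh 2t cos φ > 0`. -/
lemma laplace_base_pos (t φ : ℝ) : 0 < Real.cosh (2 * t) - Real.sinh (2 * t) * Real.cos φ := by
  have h : Real.cosh (2 * t) - Real.sinh (2 * t) * Real.cos φ = gnorm t φ ^ 2 := by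
    rw [gnorm_sq, Real.cosh_two_mul, Real.sinh_two_mul]
    ring
  rw [h]
  exact pow_pos (gnorm_pos t φ) 2

/-- **The Laplace integrand `(λ, t, φ) ↦ (cosh 2t - sinh 2t cos φ)^{-λ/2}` is jointly continuous.** -/
lemma continuous_laplace_integrand :
    Continuous fun p : (ℝ × ℝ) × ℝ =>
      (Real.cosh (2 * p.1.2) - Real.sinh (2 * p.1.2) * Real.cos p.2) ^ (-p.1.1 / 2) := by
  have hbase : Continuous fun p : (ℝ × ℝ) × ℝ =>
      Real.cosh (2 * p.1.2) - Real.sinh (2 * p.1.2) * Real.cos p.2 := by fun_prop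
  have hexp : Continuous fun p : (ℝ × ℝ) × ℝ => -p.1.1 / 2 := by fun_prop
  exact hbase.rpow hexp fun p => Or.inl (laplace_base_pos p.1.2 p.2).ne'

section measure

variable [MeasurableSpace Circle] [BorelSpace Circle]

/-- **`(λ, t) ↦ sph λ (a_t)` is continuous** (the parametric Laplace integral). -/
theorem continuous_sph_hyp_uncurry : Continuous fun p : ℝ × ℝ => sph p.1 (hyp p.2) := by
  have e : (fun p : ℝ × ℝ => sph p.1 (hyp p.2)) = fun p : ℝ × ℝ =>
      (2 * π)⁻¹ * ∫ φ in (-π)..π,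
        (Real.cosh (2 * p.2) - Real.sinh (2 * p.2) * Real.cos φ) ^ (-p.1 / 2) := by
    funext p
    exact sph_hyp_eq_laplace p.1 p.2
  rw [e]
  refine continuous_const.mul ?_
  exact continuous_parametric_intervalIntegral_of_continuous'
    (f := fun (p : ℝ × ℝ) (φ : ℝ) =>
      (Real.cosh (2 * p.2) - Real.sinh (2 * p.2) * Real.cos φ) ^ (-p.1 / 2))
    continuous_laplace_integrand (-π) π

/-- **Joint continuity**: `(λ, g) ↦ sph λ g` is continuous on `ℝ × SU(1,1)`. -/
theorem continuous_sph_uncurry : Continuous fun p : ℝ × SU11 => sph p.1 p.2 := by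
  have e : (fun p : ℝ × SU11 => sph p.1 p.2) =
      (fun q : ℝ × ℝ => sph q.1 (hyp q.2)) ∘ fun p : ℝ × SU11 => (p.1, cartanT p.2) := by
    funext p
    exact sph_eq_sph_hyp_cartanT p.1 p.2
  rw [e]
  exact continuous_sph_hyp_uncurry.comp (continuous_fst.prodMk (continuous_cartanT.comp continuous_snd))

/-- **Every spherical function is continuous on `SU(1,1)`.** -/
theorem continuous_sph (lam : ℝ) : Continuous (sph lam) :=
  continuous_sph_uncurry.comp (Continuous.prodMk continuous_const continuous_id)

/-- **`λ ↦ sph λ g` is continuous** for every `g`. -/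
theorem continuous_sph_param (g : SU11) : Continuous fun lam : ℝ => sph lam g :=
  continuous_sph_uncurry.comp (Continuous.prodMk continuous_id continuous_const)

/-- `t ↦ sph λ (a_t)` is continuous. -/
theorem continuous_sph_hyp (lam : ℝ) : Continuous fun t : ℝ => sph lam (hyp t) :=
  continuous_sph_hyp_uncurry.comp (Continuous.prodMk continuous_const continuous_id)

/-- `sph λ k = 1` on `K`. -/
theorem sph_rot (lam : ℝ) (u : Circle) : sph lam (rot u) = 1 := by
  rw [← one_mul (rot u), sph_mul_rot, sph_one]

end measure

end Summit.Ventures.HodgeRepro2.T5SU11SphericalContinuous
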